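import Literature.NumberTheory.EllipticCurves.StevensSmoothingTransformProofs
import Summits.BirchSwinnertonDyer.BirchSwinnertonDyer.Theorems.EisensteinDepletionAtTwoStarGlue
import Summits.BirchSwinnertonDyer.BirchSwinnertonDyer.Theorems.EisensteinDepletionAtTwoStarCoreReduction
import Summits.BirchSwinnertonDyer.BirchSwinnertonDyer.Theorems.EisensteinDepletionAtTwoStarSmoothedMeasure
import Summits.BirchSwinnertonDyer.BirchSwinnertonDyer.Theorems.EisensteinDepletionAtTwoStarLevelElement
import Summits.BirchSwinnertonDyer.BirchSwinnertonDyer.Theorems.EisensteinDepletionAtTwoStarTransfer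
import HarnessLib

/-!
# Route `EisensteinDepletionAtTwo`, crux E1M `DepletedLambdaLawAtTwoMod` (item stmt-BirchSwinnertonDyer-20341),
# line `star` — (★-GlueFin), part 1: the POINTWISE cusp congruence in the `8`-normalisation and its Stevens smoothing;
# `Sm_5^5 μ` is a bounded (even) distribution; `red(26 − 5(1+T) − 5(1+T)⁻¹) = X²·red((1+T)⁻¹)`

Cell `bsd-rank2`, seat `bsd-rank2-eng-2` GEN 8. THEOREMS ONLY — no definition, no named fact, no `sorry`. HONEST FRAMING:
`Λ`-bookkeeping and elementary `2`-adic estimates (the finite-level variant of the lead's `red_pfree_eq_of_cuspCongruence`,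
p551400, proposed in evidence #39 on the item): the two halves of (★) enter as HYPOTHESES about an arbitrary function
`v : ℕ → ℤ → ℚ` — the cusp congruence `hC` ((★-SymbC′): on `C`, `([a/2^m]⁺_f − [1/2^m]⁺_f)/g ∈ ℤ` is congruent to `v(m,a)/8`
modulo `2ℤ₂`) and the smoothed Riemann-sum congruence `hH` (the output (i) of `starEisFin` for `v = stabEisCuspDiff N β`);
nothing here proves either, nothing reads an analytic rank, BSD is not proved by any of this (PARTITION D-0054: none — r_an ≥ 2
axis S0, door T-r3₂). DIFFERENCE with p551400: no `2`-adic CONVERGENCE of the Eisenstein Riemann sums is assumed; instead BOTH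
sides are smoothed by Stevens' `Sm_5^5` (lit's `stevensSmoothing 5`), whose transform on the bounded distribution `μ_f` is
`(26 − 5(1+T) − 5(1+T)⁻¹)·L₂(f, α)` (lit GEN 21, `distributionTransform_stevensSmoothing_five`) with
`red(26 − 5(1+T) − 5(1+T)⁻¹) = X²·red((1+T)⁻¹)` — this is where the `T²` of (★) comes from.

* §1 `norm_msdMeasure_sub_norm8_le_half`: pointwise on the `η = +1` classes of level `n+2 ≥ 4`,
  `‖g⁻¹(μ_f(a) − μ_f(1)) − ν₈(a)‖₂ ≤ 2⁻¹` (`ν₈` = the `C`-normalised `v`-measure in the `8`-normalisation).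
* §2 `norm_stevensSmoothing_msdMeasure_sub_le_half`: the same after smoothing,
  `‖g⁻¹((Sm μ_f)(a) − 16μ_f(1)) − (Sm ν₈)(a)‖₂ ≤ 2⁻¹`; `stevensSmoothing_distribution`, `norm_stevensSmoothing_le`.
* `red_smoothingElement`: `red(26 − 5(1+T) − 5(1+T)⁻¹) = X²·red((1+T)⁻¹)` (`2 = 0` in `𝔽₂⟦T⟧`).
  The glue theorem itself (`sq_X_mul_red_pfree_eq_of_cuspCongruence8`) is the sequel file `…StarGlueFin.lean`.

References: B. Mazur, J. Tate, J. Teitelbaum, Invent. Math. 84 (1986), §I.10–I.13 [MazurTateTeitelbaum1986Invent]; G. Stevens,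
*Arithmetic on Modular Curves* (1982), §5.4 [Stevens1982]; R. Greenberg, V. Vatsal, Invent. Math. 142 (2000), §3 [GreenbergVatsal2000].
-/

set_option linter.dupNamespace false
set_option autoImplicit false

noncomputable section

open scoped Classical
open scoped MatrixGroups

open Filter Topology CongruenceSubgroup
  Literature.NumberTheory.EllipticCurves Literature.NumberTheory.EllipticCurves.ModularForms
  Summit.BirchSwinnertonDyer.Rank1Residual.X1.MuLambda

namespace Summit.BirchSwinnertonDyer.BirchSwinnertonDyer.Theorems.DepletionAtTwo

/-! ## §1. The pointwise congruence in the `8`-normalisation -/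

section Pointwise8

variable {N : ℕ} [NeZero N] (f : CuspForm (Gamma0 N) 2)

omit [NeZero N] in
/-- The `C`-congruence in the `8`-normalisation, extended to the class of `1` (where both sides vanish).
[cite: MazurTateTeitelbaum1986Invent, §I.10 (10.1)] -/
theorem cuspCongruence8_of_C (v : ℕ → ℤ → ℚ) (hv1 : ∀ m : ℕ, v m 1 = 0) (g : ℚ)
    (hC : ∀ (m : ℕ) (a : ℤ), 3 ≤ m → a % 4 = 1 → 1 < a → a < 2 ^ m →
      ∃ n : ℤ, ratPlusSymbol f ((a : ℚ) / (2 ^ m : ℕ)) - ratPlusSymbol f (1 / (2 ^ m : ℕ)) = n * g ∧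
        ‖(n : ℚ_[2]) - ((v m a / 8 : ℚ) : ℚ_[2])‖ ≤ 2⁻¹)
    (m b : ℕ) (hm : 3 ≤ m) (hb4 : b % 4 = 1) (hb : b < 2 ^ m) :
    ∃ n : ℤ, ratPlusSymbol f ((b : ℚ) / (2 : ℚ) ^ m) = n * g + ratPlusSymbol f (1 / (2 : ℚ) ^ m) ∧
      ‖(n : ℚ_[2]) - ((v m b / 8 : ℚ) : ℚ_[2])‖ ≤ 2⁻¹ := by
  by_cases h1 : b = 1
  · subst h1
    refine ⟨0, ?_, ?_⟩
    · push_cast; ring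
    · rw [Nat.cast_one, hv1]; simp
  · have h1' : 1 < (b : ℤ) := by omega
    have hb4' : (b : ℤ) % 4 = 1 := by omega
    have hb' : (b : ℤ) < 2 ^ m := by exact_mod_cast hb
    obtain ⟨n, h, hn⟩ := hC m b hm hb4' h1' hb'
    refine ⟨n, ?_, by exact_mod_cast hn⟩
    push_cast at h
    linear_combination h

variable {W : WeierstrassCurve ℚ} [W.IsElliptic] [W.IsGloballyMinimal]

omit [W.IsElliptic] in
/-- **The pointwise congruence in the `8`-normalisation.** On the `η = +1` unit class `a ≡ 1 (mod 4)` of level `n + 2`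
(`n ≥ 2`): `‖g⁻¹(μ_f(a) − μ_f(1)) − (v(n+2, a) − v(n+1, a mod 2ⁿ⁺¹))/8‖₂ ≤ 1/2`, from the `C`-congruence in the
`8`-normalisation (the unit root `α ≡ 1 (mod 2)`; periodicity of `[·]⁺`). [cite: MazurTateTeitelbaum1986Invent, §I.10–I.13] -/
theorem norm_msdMeasure_sub_norm8_le_half (hord : IsOrdinaryAt W 2)
    (v : ℕ → ℤ → ℚ) (hv1 : ∀ m : ℕ, v m 1 = 0) (g : ℚ) (hg : g ≠ 0)
    (hC : ∀ (m : ℕ) (a : ℤ), 3 ≤ m → a % 4 = 1 → 1 < a → a < 2 ^ m →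
      ∃ n : ℤ, ratPlusSymbol f ((a : ℚ) / (2 ^ m : ℕ)) - ratPlusSymbol f (1 / (2 ^ m : ℕ)) = n * g ∧
        ‖(n : ℚ_[2]) - ((v m a / 8 : ℚ) : ℚ_[2])‖ ≤ 2⁻¹)
    {n : ℕ} (hn : 2 ≤ n) (a : ZMod (2 ^ (n + 2))) (ha : a.val % 4 = 1) :
    ‖((g : ℚ_[2]))⁻¹ * (msdMeasure f (unitRoot W 2 : ℚ_[2]) (n + 2) a -
        msdMeasure f (unitRoot W 2 : ℚ_[2]) (n + 2) 1) -
      (((v (n + 2) (a.val : ℤ) - v (n + 1) ((a.val % 2 ^ (n + 1) : ℕ) : ℤ)) / 8 : ℚ) : ℚ_[2])‖ ≤ 2⁻¹ := by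
  set α : ℚ_[2] := (unitRoot W 2 : ℚ_[2]) with hα
  set A : ℕ := a.val with hA
  set abar : ℕ := A % 2 ^ (n + 1) with habar
  have hAlt : A < 2 ^ (n + 2) := ZMod.val_lt a
  have h4 : 4 ∣ 2 ^ (n + 1) := by
    have := pow_dvd_pow 2 (show 2 ≤ n + 1 by omega); simpa using this
  have habar4 : abar % 4 = 1 := by
    rw [habar, Nat.mod_mod_of_dvd _ h4]
    exact ha
  have habarlt : abar < 2 ^ (n + 1) := Nat.mod_lt _ (pow_pos two_pos _)
  obtain ⟨n₁, hS1, hc1⟩ := cuspCongruence8_of_C f v hv1 g hC (n + 2) A (by omega) ha hAlt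
  obtain ⟨n₂, hS2, hc2⟩ := cuspCongruence8_of_C f v hv1 g hC (n + 1) abar (by omega) habar4 habarlt
  have hone : (1 : ZMod (2 ^ (n + 2))).val = 1 := by
    rw [ZMod.val_one_eq_one_mod, Nat.mod_eq_of_lt (Nat.one_lt_two_pow (by omega))]
  have hμa := msdMeasure_level_add_two f α n a
  have hμ1 := msdMeasure_level_add_two f α n 1
  rw [← hA, ratPlusSymbol_div_two_pow_eq_mod f (n + 1) A, ← habar, hS1, hS2] at hμa
  rw [hone, Nat.cast_one] at hμ1
  have hν : (( ((v (n + 2) (A : ℤ) - v (n + 1) (abar : ℤ)) / 8 : ℚ) : ℚ_[2])) =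
      ((v (n + 2) (A : ℤ) / 8 : ℚ) : ℚ_[2]) - ((v (n + 1) (abar : ℤ) / 8 : ℚ) : ℚ_[2]) := by
    push_cast; ring
  rw [hμa, hμ1, hν]
  have hgq : (g : ℚ_[2]) ≠ 0 := by exact_mod_cast hg
  have hid : (g : ℚ_[2])⁻¹ * (α⁻¹ ^ (n + 2) * (((n₁ : ℚ) * g + ratPlusSymbol f (1 / (2 : ℚ) ^ (n + 2)) : ℚ) : ℚ_[2]) -
        α⁻¹ ^ (n + 3) * (((n₂ : ℚ) * g + ratPlusSymbol f (1 / (2 : ℚ) ^ (n + 1)) : ℚ) : ℚ_[2]) -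
        (α⁻¹ ^ (n + 2) * ((ratPlusSymbol f ((1 : ℚ) / (2 : ℚ) ^ (n + 2)) : ℚ) : ℚ_[2]) -
          α⁻¹ ^ (n + 3) * ((ratPlusSymbol f ((1 : ℚ) / (2 : ℚ) ^ (n + 1)) : ℚ) : ℚ_[2]))) -
      (((v (n + 2) (A : ℤ) / 8 : ℚ) : ℚ_[2]) - ((v (n + 1) (abar : ℤ) / 8 : ℚ) : ℚ_[2])) =
      ((α⁻¹ ^ (n + 2) - 1) * (n₁ : ℚ_[2]) + ((n₁ : ℚ_[2]) - ((v (n + 2) (A : ℤ) / 8 : ℚ) : ℚ_[2]))) -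
        ((α⁻¹ ^ (n + 3) - 1) * (n₂ : ℚ_[2]) + ((n₂ : ℚ_[2]) - ((v (n + 1) (abar : ℤ) / 8 : ℚ) : ℚ_[2]))) := by
    push_cast
    field_simp
    ring
  rw [hid]
  refine norm_sub_le_of_le_two (norm_add_le_of_le_two ?_ hc1) (norm_add_le_of_le_two ?_ hc2)
  · rw [norm_mul]
    calc ‖α⁻¹ ^ (n + 2) - 1‖ * ‖(n₁ : ℚ_[2])‖ ≤ 2⁻¹ * 1 := by
          gcongr
          · exact norm_unitRoot_inv_pow_sub_one_le_half hord _
          · exact Padic.norm_int_le_one n₁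
      _ = 2⁻¹ := mul_one _
  · rw [norm_mul]
    calc ‖α⁻¹ ^ (n + 3) - 1‖ * ‖(n₂ : ℚ_[2])‖ ≤ 2⁻¹ * 1 := by
          gcongr
          · exact norm_unitRoot_inv_pow_sub_one_le_half hord _
          · exact Padic.norm_int_le_one n₂
      _ = 2⁻¹ := mul_one _

end Pointwise8

/-! ## §2. Smoothing the pointwise congruence; `Sm μ` is a bounded distribution -/

section Smoothed

variable {N : ℕ} [NeZero N] (f : CuspForm (Gamma0 N) 2) {W : WeierstrassCurve ℚ} [W.IsElliptic] [W.IsGloballyMinimal]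

omit [W.IsElliptic] in
/-- **The smoothed pointwise congruence.** With `Sm = Sm_5^5` (`(Sm ρ)(a) = ρ(a) − 5ρ(a·5⁻¹) − 5ρ(a·5) + 25ρ(a)`):
on every `η = +1` class `a` of level `n+2 ≥ 4`, `‖g⁻¹((Sm μ_f)(a) − 16·μ_f(1)) − (Sm ν₈)(a)‖₂ ≤ 2⁻¹`
(the four classes `a, a·5⁻¹, a·5, a` are `η = +1` classes; `1 − 5 − 5 + 25 = 16`). [cite: Stevens1982, §5.4 (PDF p. 73)]
[cite: MazurTateTeitelbaum1986Invent, §I.10–I.13] -/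
theorem norm_stevensSmoothing_msdMeasure_sub_le_half (hord : IsOrdinaryAt W 2)
    (v : ℕ → ℤ → ℚ) (hv1 : ∀ m : ℕ, v m 1 = 0) (g : ℚ) (hg : g ≠ 0)
    (hC : ∀ (m : ℕ) (a : ℤ), 3 ≤ m → a % 4 = 1 → 1 < a → a < 2 ^ m →
      ∃ n : ℤ, ratPlusSymbol f ((a : ℚ) / (2 ^ m : ℕ)) - ratPlusSymbol f (1 / (2 ^ m : ℕ)) = n * g ∧
        ‖(n : ℚ_[2]) - ((v m a / 8 : ℚ) : ℚ_[2])‖ ≤ 2⁻¹)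
    {n : ℕ} (hn : 2 ≤ n) (a : ZMod (2 ^ (n + 2))) (ha : a.val % 4 = 1) :
    ‖((g : ℚ_[2]))⁻¹ * (stevensSmoothing 5 (msdMeasure f (unitRoot W 2 : ℚ_[2])) (n + 2) a -
        16 * msdMeasure f (unitRoot W 2 : ℚ_[2]) (n + 2) 1) -
      stevensSmoothing 5 (fun m b ↦ if 4 ≤ m ∧ b.val % 4 = 1 then
        (((v m (b.val : ℤ) - v (m - 1) ((b.val % 2 ^ (m - 1) : ℕ) : ℤ)) / 8 : ℚ) : ℚ_[2]) else 0) (n + 2) a‖ ≤ 2⁻¹ := by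
  set μ := msdMeasure f (unitRoot W 2 : ℚ_[2]) with hμ
  set ν : (m : ℕ) → ZMod (2 ^ m) → ℚ_[2] := fun m b ↦ if 4 ≤ m ∧ b.val % 4 = 1 then
    (((v m (b.val : ℤ) - v (m - 1) ((b.val % 2 ^ (m - 1) : ℕ) : ℤ)) / 8 : ℚ) : ℚ_[2]) else 0 with hν
  obtain ⟨hp4, hm4⟩ := val_shift_mod_four (by omega : 3 ≤ n + 2) a ha
  -- the pointwise differences on the three classes
  have hD : ∀ x : ZMod (2 ^ (n + 2)), x.val % 4 = 1 →
      ‖(g : ℚ_[2])⁻¹ * (μ (n + 2) x - μ (n + 2) 1) - ν (n + 2) x‖ ≤ 2⁻¹ := by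
    intro x hx
    have h := norm_msdMeasure_sub_norm8_le_half f hord v hv1 g hg hC hn x hx
    have hνx : ν (n + 2) x = (((v (n + 2) (x.val : ℤ) - v (n + 1) ((x.val % 2 ^ (n + 1) : ℕ) : ℤ)) / 8 : ℚ) : ℚ_[2]) := by
      simp only [hν, if_pos (show 4 ≤ n + 2 ∧ x.val % 4 = 1 from ⟨by omega, hx⟩), show n + 2 - 1 = n + 1 by omega]
    rw [hνx]; exact h
  rw [stevensSmoothing_five_apply, stevensSmoothing_five_apply]
  have hid : (g : ℚ_[2])⁻¹ * (μ (n + 2) a - 5 * μ (n + 2) (a * ((5 : ℕ) : ZMod (2 ^ (n + 2)))⁻¹) -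
        5 * μ (n + 2) (a * ((5 : ℕ) : ZMod (2 ^ (n + 2)))) + 25 * μ (n + 2) a - 16 * μ (n + 2) 1) -
      (ν (n + 2) a - 5 * ν (n + 2) (a * ((5 : ℕ) : ZMod (2 ^ (n + 2)))⁻¹) -
        5 * ν (n + 2) (a * ((5 : ℕ) : ZMod (2 ^ (n + 2)))) + 25 * ν (n + 2) a) =
      ((g : ℚ_[2])⁻¹ * (μ (n + 2) a - μ (n + 2) 1) - ν (n + 2) a) -
        5 * ((g : ℚ_[2])⁻¹ * (μ (n + 2) (a * ((5 : ℕ) : ZMod (2 ^ (n + 2)))⁻¹) - μ (n + 2) 1) -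
          ν (n + 2) (a * ((5 : ℕ) : ZMod (2 ^ (n + 2)))⁻¹)) -
        5 * ((g : ℚ_[2])⁻¹ * (μ (n + 2) (a * ((5 : ℕ) : ZMod (2 ^ (n + 2)))) - μ (n + 2) 1) -
          ν (n + 2) (a * ((5 : ℕ) : ZMod (2 ^ (n + 2))))) +
        25 * ((g : ℚ_[2])⁻¹ * (μ (n + 2) a - μ (n + 2) 1) - ν (n + 2) a) := by ring
  rw [hid]
  have h5 : ∀ {x : ℚ_[2]}, ‖x‖ ≤ 2⁻¹ → ‖(5 : ℚ_[2]) * x‖ ≤ 2⁻¹ := fun {x} hx ↦ by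
    rw [norm_mul]
    calc ‖(5 : ℚ_[2])‖ * ‖x‖ ≤ 1 * 2⁻¹ := by
          gcongr; exact_mod_cast Padic.norm_int_le_one (p := 2) 5
      _ = 2⁻¹ := one_mul _
  have h25 : ∀ {x : ℚ_[2]}, ‖x‖ ≤ 2⁻¹ → ‖(25 : ℚ_[2]) * x‖ ≤ 2⁻¹ := fun {x} hx ↦ by
    rw [norm_mul]
    calc ‖(25 : ℚ_[2])‖ * ‖x‖ ≤ 1 * 2⁻¹ := by
          gcongr; exact_mod_cast Padic.norm_int_le_one (p := 2) 25
      _ = 2⁻¹ := one_mul _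
  exact norm_add_le_of_le_two (norm_sub_le_of_le_two (norm_sub_le_of_le_two (hD a ha) (h5 (hD _ hm4)))
    (h5 (hD _ hp4))) (h25 (hD a ha))

variable {μ : (n : ℕ) → ZMod (2 ^ n) → ℚ_[2]}

omit [NeZero N] in
/-- **`Sm_5^5 μ` satisfies the distribution relation** if `μ` does (linearity; `[5]_*`, `[5]^*` preserve it).
[cite: Stevens1982, §5.4 Prop. 5.4.1 (PDF p. 73)] -/
theorem stevensSmoothing_distribution
    (hμ : ∀ (n : ℕ) (a : ZMod (2 ^ n)),
      ∑ b ∈ Finset.univ.filter (fun b : ZMod (2 ^ (n + 1)) ↦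
        ZMod.castHom (pow_dvd_pow 2 n.le_succ) (ZMod (2 ^ n)) b = a), μ (n + 1) b = μ n a)
    (n : ℕ) (a : ZMod (2 ^ n)) :
    ∑ b ∈ Finset.univ.filter (fun b : ZMod (2 ^ (n + 1)) ↦
        ZMod.castHom (pow_dvd_pow 2 n.le_succ) (ZMod (2 ^ n)) b = a), stevensSmoothing 5 μ (n + 1) b =
      stevensSmoothing 5 μ n a := by
  have h5 : (2 : ℕ).Coprime 5 := by norm_num
  simp only [stevensSmoothing_def, Pi.add_apply, Pi.sub_apply, Pi.smul_apply, smul_eq_mul, Finset.sum_add_distrib,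
    Finset.sum_sub_distrib, ← Finset.mul_sum, hμ n a, dilate_distribution h5 hμ n a, codilate_distribution h5 hμ n a]

omit [NeZero N] in
/-- **`Sm_5^5 μ` is bounded** by any bound of `μ` (ultrametric). [cite: Stevens1982, §5.4 (PDF p. 73)] -/
theorem norm_stevensSmoothing_le {C : ℝ} (hC : ∀ (n : ℕ) (a : ZMod (2 ^ n)), ‖μ n a‖ ≤ C) (n : ℕ)
    (a : ZMod (2 ^ n)) : ‖stevensSmoothing 5 μ n a‖ ≤ C := by
  have hC0 : 0 ≤ C := (norm_nonneg _).trans (hC 0 0)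
  rw [stevensSmoothing_five_apply]
  have h5 : ∀ (x : ZMod (2 ^ n)), ‖(5 : ℚ_[2]) * μ n x‖ ≤ C := fun x ↦ by
    rw [norm_mul]
    calc ‖(5 : ℚ_[2])‖ * ‖μ n x‖ ≤ 1 * C :=
          mul_le_mul (by exact_mod_cast Padic.norm_int_le_one (p := 2) 5) (hC n x) (norm_nonneg _) zero_le_one
      _ = C := one_mul _
  have h25 : ‖(25 : ℚ_[2]) * μ n a‖ ≤ C := by
    rw [norm_mul]
    calc ‖(25 : ℚ_[2])‖ * ‖μ n a‖ ≤ 1 * C :=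
          mul_le_mul (by exact_mod_cast Padic.norm_int_le_one (p := 2) 25) (hC n a) (norm_nonneg _) zero_le_one
      _ = C := one_mul _
  exact norm_add_le_of_le_two (norm_sub_le_of_le_two (norm_sub_le_of_le_two (hC n a) (h5 _)) (h5 _)) h25

omit [NeZero N] in
/-- `Sm_5^5` of an even set function is even. [cite: Stevens1982, §5.4 (PDF p. 73)] -/
theorem stevensSmoothing_neg (hμ : ∀ (n : ℕ) (a : ZMod (2 ^ n)), μ n (-a) = μ n a) (n : ℕ) (a : ZMod (2 ^ n)) :
    stevensSmoothing 5 μ n (-a) = stevensSmoothing 5 μ n a := by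
  rw [stevensSmoothing_five_apply, stevensSmoothing_five_apply, neg_mul, neg_mul, hμ, hμ, hμ]

end Smoothed

section GlueFin

variable {N : ℕ} [NeZero N] (f : CuspForm (Gamma0 N) 2) {W : WeierstrassCurve ℚ} [W.IsElliptic] [W.IsGloballyMinimal]

/-- The smoothing element `Sm_Λ = 26 − 5(1+T) − 5(1+T)⁻¹ ∈ Λ` reduces to `X²·red((1+T)⁻¹)` in `𝔽₂⟦T⟧`
(`26 ≡ 0`, `5 ≡ 1`, `(1+T) + (1+T)⁻¹ = (1+T)⁻¹((1+T)² + 1) = (1+T)⁻¹T²`). [cite: Stevens1982, §5.4 (PDF p. 74)] -/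
theorem red_smoothingElement :
    red (PowerSeries.C (26 : ℤ_[2]) - PowerSeries.C (5 : ℤ_[2]) * PowerSeries.binomialSeries ℤ_[2] (1 : ℤ_[2]) -
        PowerSeries.C (5 : ℤ_[2]) * PowerSeries.binomialSeries ℤ_[2] (-1 : ℤ_[2])) =
      PowerSeries.X ^ 2 * red (PowerSeries.binomialSeries ℤ_[2] (-1 : ℤ_[2])) := by
  have h26 : red (PowerSeries.C (26 : ℤ_[2])) = 0 := by
    unfold red
    rw [PowerSeries.map_C, show (26 : ℤ_[2]) = ((26 : ℤ) : ℤ_[2]) by norm_num, map_intCast, map_intCast]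
    exact intCast_powerSeries_eq_zero_of_even ⟨13, by norm_num⟩
  have h5 : red (PowerSeries.C (5 : ℤ_[2])) = 1 := by
    unfold red
    rw [PowerSeries.map_C, show (5 : ℤ_[2]) = ((5 : ℤ) : ℤ_[2]) by norm_num, map_intCast, map_intCast,
      show ((5 : ℤ) : PowerSeries (IsLocalRing.ResidueField ℤ_[2])) = 2 * 2 + 1 by norm_num,
      two_eq_zero_powerSeries_residueField_two, zero_mul, zero_add]
  have hbs1 : red (PowerSeries.binomialSeries ℤ_[2] (1 : ℤ_[2])) = 1 + PowerSeries.X := by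
    have h := PowerSeries.binomialSeries_nat (R := ℤ_[2]) (A := ℤ_[2]) 1
    rw [Nat.cast_one, pow_one] at h
    unfold red
    rw [h, map_add, map_one, PowerSeries.map_X]
  have hinv : (1 + PowerSeries.X) * red (PowerSeries.binomialSeries ℤ_[2] (-1 : ℤ_[2])) = 1 := by
    rw [← hbs1, ← red_mul', ← PowerSeries.binomialSeries_add, add_neg_cancel, PowerSeries.binomialSeries_zero]
    unfold red; rw [map_one]
  unfold red at h26 h5 hbs1 hinv ⊢
  rw [map_sub, map_sub, map_mul, map_mul, h26, h5, hbs1, one_mul, one_mul, zero_sub]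
  set γi := (PowerSeries.map (IsLocalRing.residue ℤ_[2])) (PowerSeries.binomialSeries ℤ_[2] (-1 : ℤ_[2]))
  -- `−(1+X) − γi = γi·X²` (characteristic 2)
  have h2 : (2 : PowerSeries (IsLocalRing.ResidueField ℤ_[2])) = 0 := two_eq_zero_powerSeries_residueField_two
  linear_combination (-(1 + PowerSeries.X)) * hinv + (PowerSeries.X * γi - 1 - PowerSeries.X) * h2

end GlueFin

end Summit.BirchSwinnertonDyer.BirchSwinnertonDyer.Theorems.DepletionAtTwo

end
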